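import Summits.KontsevichZagierPeriods.KontsevichZagierPeriods.Theorems.RootDecompWalshStrataSplit4Pieces
import Literature.NumberTheory.Transcendental.KZHomotopyMoves
import Literature.NumberTheory.Transcendental.KZUnfolding

/-!
# The split specimen meets Euler, part 2/2: the rational pieces are the constants `−5q/8`, `−q/8`

Route `RootDecompWalshStrata` (cell decomp-kz, lens 4, gen 12), support toward `QuadricSignKernel`
(item stmt-KontsevichZagierPeriods-25393), slice `d = 4`.  Part 1 (`Split4Pieces`) wrote the rational
2-cell `Δ_q` of the split quadric cell as `zRep (q/2) + A_q + B_q` inside the rules.  Here the two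
rational pieces are integrated out INSIDE the rules: one generic Newton–Leibniz move along `t₁` over
the base `(0,1)` (closed fibres `[1 − t₀, 1]`, primitive `q(t₁² − 4t₁)/(4t₀) + e·t₁`) sends
`[Δ, q(t₁−2)/(2t₀) + e]` to the affine 1-cell `[(0,1), (e − q/4)t₀ − q/2]`, and a second
Newton–Leibniz move sends `[(0,1), αt₀ + β]` to the point `[pt, α/2 + β] = cstRep (α/2 + β)`;
`A_q` is first flipped to `[Δ, q(t₁−2)/(2t₀)]` by the coordinate swap (rule (2)).  Results:
`of_aRep_sub_of_cstRep_mem_relations : [A_q] − [pt, −5q/8] ∈ KZ.relations`,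
`of_bRep_sub_of_cstRep_mem_relations : [B_q] − [pt, −q/8] ∈ KZ.relations`, and the assembled
**`of_split4_cell_sub_mem_relations :
  [(0,1)⁴ ∩ {x₀x₁+x₂x₃ > 1}, q] − ([zRep (q/2)] + [pt, −3q/4]) ∈ KZ.relations`**
(values: `q(π²/12 − 3/4)` both sides) — the split genus is, unconditionally and inside the three
rules, Beukers' `ζ(2)`-square plus a rational point.  0 sorry.
[KontsevichZagier2001 §1.2; Beukers1979 §2; this node]
-/

noncomputable section

open Literature.NumberTheory.Transcendental
open MeasureTheory Set
open MvPolynomial (aeval X C)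
open Literature.ModelTheory.ExponentialFields (IsSemialgebraic isSemialgebraic_univ)
open Summit.KontsevichZagierPeriods.RootDecompWalshStrata.Ball4 (ivSet isSemialgebraic_ivSet
  ivSet_subset_Icc sqSet isSemialgebraic_sqSet sqSet_subset_Icc)
open Summit.KontsevichZagierPeriods.RootDecompWalshStrata.Split4 (triSet triRep triRep_domain
  triRep_integrand mem_triSet isSemialgebraic_triSet triSet_subset_Icc integrableOn_of_bdd split4Poly
  of_cell_sub_of_triRep_mem_relations)
open Summit.KontsevichZagierPeriods.RootDecompWalshStrata.PiSector (cstRep cstRep_domain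
  cstRep_integrand of_cstRep_add)
open Summit.KontsevichZagierPeriods.RootDecompWalshStrata.WalshSpanProof (cellRep)

namespace Summit.KontsevichZagierPeriods.RootDecompWalshStrata.Split4Pi

/-! #### Small coordinate facts in dimensions 0, 1, 2 -/

/-- Membership in `(0,1) ⊆ ℝ¹`. [definition] -/
private theorem mem_ivSet_iff {t : Fin 1 → ℝ} : t ∈ ivSet ↔ 0 < t 0 ∧ t 0 < 1 := by
  simp [ivSet, Fin.forall_fin_one]

/-- `(snoc t s)₀ = t₀` on `ℝ¹ × ℝ`. [definition] -/
@[simp] private theorem snoc1_zero (t : Fin 1 → ℝ) (s : ℝ) : (Fin.snoc t s : Fin 2 → ℝ) 0 = t 0 := rfl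
/-- `(snoc t s)₁ = s` on `ℝ¹ × ℝ`. [definition] -/
@[simp] private theorem snoc1_one (t : Fin 1 → ℝ) (s : ℝ) : (Fin.snoc t s : Fin 2 → ℝ) 1 = s := rfl
/-- `(snoc x s)₀ = s` on `ℝ⁰ × ℝ`. [definition] -/
@[simp] private theorem snoc0_zero (x : Fin 0 → ℝ) (s : ℝ) : (Fin.snoc x s : Fin 1 → ℝ) 0 = s := rfl
/-- `(init v)₀ = v₀` for `v ∈ ℝ²`. [definition] -/
private theorem init2_zero (v : Fin 2 → ℝ) : Fin.init v 0 = v 0 := rfl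
/-- `last 1 = 1` in `Fin 2`. [definition] -/
private theorem last_one_eq : (Fin.last 1 : Fin 2) = 1 := rfl
/-- `last 0 = 0` in `Fin 1`. [definition] -/
theorem last_zero_eq : (Fin.last 0 : Fin 1) = 0 := rfl

/-- Integrability on a set extends across a null set. [folklore] -/
theorem integrableOn_of_null_diff {n : ℕ} {f : (Fin n → ℝ) → ℝ} {O S : Set (Fin n → ℝ)}
    (hO : IntegrableOn f O) (hOS : O ⊆ S) (hnull : volume (S \ O) = 0) : IntegrableOn f S := by
  rw [← Set.union_sdiff_cancel hOS]
  refine hO.union ?_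
  rw [IntegrableOn, Measure.restrict_eq_zero.2 hnull]
  exact integrable_zero_measure

/-! #### The affine 1-cell and the generic Newton–Leibniz move `Δ → (0,1)` -/

/-- **`affRep α β = [(0,1), αt₀ + β]`.** [KontsevichZagier2001 §1.1] -/
def affRep (α β : ℚ) : KZ.IntegralRep 1 where
  domain := ivSet
  integrand t := (α : ℝ) * t 0 + β
  isSemialgebraic_domain := isSemialgebraic_ivSet
  isSemialgebraicFunOn_integrand :=
    (isSemialgebraicFunOn_aeval isSemialgebraic_ivSet (C α * X 0 + C β)).congr fun t _ => by simp
  integrableOn := integrableOn_of_bdd ivSet_subset_Icc isSemialgebraic_ivSet.measurableSet_holds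
    (by fun_prop) (|(α : ℝ)| + |(β : ℝ)|) fun t ht => by
      have h := (mem_ivSet_iff.1 ht)
      calc |(α : ℝ) * t 0 + β| ≤ |(α : ℝ) * t 0| + |(β : ℝ)| := abs_add_le _ _
        _ ≤ |(α : ℝ)| + |(β : ℝ)| := by
          rw [abs_mul, abs_of_pos h.1]
          nlinarith [abs_nonneg (α : ℝ)]

/-- The domain of `affRep α β`. [definition] -/
@[simp] theorem affRep_domain (α β : ℚ) : (affRep α β).domain = ivSet := rfl
/-- The integrand of `affRep α β`. [definition] -/
@[simp] theorem affRep_integrand (α β : ℚ) (t : Fin 1 → ℝ) :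
    (affRep α β).integrand t = (α : ℝ) * t 0 + β := rfl

/-- Lower fibre edge `t ↦ 1 − t₀` over `(0,1)`. [definition] -/
def loEdge₁ : (Fin 1 → ℝ) → ℝ := fun t => 1 - t 0
/-- Upper fibre edge `t ↦ 1` over `(0,1)`. [definition] -/
def upEdge₁ : (Fin 1 → ℝ) → ℝ := fun _ => 1

/-- `loEdge₁` is semialgebraic. [BCR1998 §2.2] -/
theorem isSemialgebraicFunOn_loEdge₁ : IsSemialgebraicFunOn ℚ ivSet loEdge₁ :=
  (isSemialgebraicFunOn_aeval isSemialgebraic_ivSet (1 - X 0)).congr fun t _ => by simp [loEdge₁]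
/-- `upEdge₁` is semialgebraic. [BCR1998 §2.2] -/
theorem isSemialgebraicFunOn_upEdge₁ : IsSemialgebraicFunOn ℚ ivSet upEdge₁ :=
  (isSemialgebraicFunOn_aeval isSemialgebraic_ivSet (C 1)).congr fun t _ => by simp [upEdge₁]

/-- The closed band over `(0,1)` with fibres `[1 − t₀, 1]`, unfolded. [definition] -/
theorem mem_band₁ {v : Fin 2 → ℝ} :
    v ∈ KZlog.band ivSet loEdge₁ upEdge₁ ↔ (0 < v 0 ∧ v 0 < 1) ∧ 1 - v 0 ≤ v 1 ∧ v 1 ≤ 1 := by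
  rw [KZlog.mem_band, mem_ivSet_iff]
  rfl

/-- The triangle lies in the closed band. [definition] -/
theorem triSet_subset_band₁ : triSet ⊆ KZlog.band ivSet loEdge₁ upEdge₁ := fun t ht => by
  obtain ⟨⟨h0, h1⟩, hc⟩ := mem_triSet.1 ht
  exact mem_band₁.2 ⟨h0, by linarith, h1.2.le⟩

/-- The closed band minus the triangle lies on the two edge graphs (a null set). [folklore] -/
theorem volume_band₁_diff_triSet : volume (KZlog.band ivSet loEdge₁ upEdge₁ \ triSet) = 0 := by
  have hcov : KZlog.band ivSet loEdge₁ upEdge₁ \ triSet ⊆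
      {z : Fin 2 → ℝ | Fin.init z ∈ ivSet ∧ z (Fin.last 1) = loEdge₁ (Fin.init z)} ∪
        {z | Fin.init z ∈ ivSet ∧ z (Fin.last 1) = upEdge₁ (Fin.init z)} := by
    intro v hv
    obtain ⟨hb, ht⟩ := hv
    have hb' := mem_band₁.1 hb
    have hB : Fin.init v ∈ ivSet := (KZlog.mem_band.1 hb).1
    simp only [mem_union, mem_setOf_eq, last_one_eq, loEdge₁, upEdge₁, init2_zero]
    rcases hb'.2.1.lt_or_eq with h1 | h1
    · rcases hb'.2.2.lt_or_eq with h2 | h2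
      · exact absurd (mem_triSet.2 ⟨⟨hb'.1, by linarith [hb'.1.2], h2⟩, by linarith⟩) ht
      · exact Or.inr ⟨hB, h2⟩
    · exact Or.inl ⟨hB, h1.symm⟩
  exact measure_mono_null hcov (measure_union_null (KZ.volume_graph_eq_zero isSemialgebraicFunOn_loEdge₁)
    (KZ.volume_graph_eq_zero isSemialgebraicFunOn_upEdge₁))

/-- The closed band is semialgebraic. [BCR1998 §2.2] -/
theorem isSemialgebraic_band₁ : IsSemialgebraic ℚ (KZlog.band ivSet loEdge₁ upEdge₁) :=
  KZlog.isSemialgebraic_band isSemialgebraicFunOn_loEdge₁ isSemialgebraicFunOn_upEdge₁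

/-- **Generic Newton–Leibniz move `Δ → (0,1)` (rules (3) + (1a)):** a representation on `Δ` with
integrand `q(t₁ − 2)/(2t₀) + e` is equivalent to `[(0,1), (e − q/4)t₀ − q/2]` (primitive
`q(t₁² − 4t₁)/(4t₀) + e·t₁` along the closed fibres `t₁ ∈ [1 − t₀, 1]`; integrability on the closed
band from that on `Δ`, the edges being null graphs). [KontsevichZagier2001 §1.2 rules (1), (3)] -/
theorem of_sub_of_affRep_mem_relations (q e : ℚ) (r : KZ.IntegralRep 2) (hr : r.domain = triSet)
    (hri : ∀ t ∈ triSet, r.integrand t = (q : ℝ) * (t 1 - 2) / (2 * t 0) + e) :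
    KZ.of r - KZ.of (affRep (e - q / 4) (-q / 2)) ∈ KZ.relations := by
  have hBs := isSemialgebraic_ivSet
  have ha := isSemialgebraicFunOn_loEdge₁
  have hb := isSemialgebraicFunOn_upEdge₁
  have hab : ∀ t ∈ ivSet, loEdge₁ t ≤ upEdge₁ t := fun t ht => by
    simp only [loEdge₁, upEdge₁]; linarith [(mem_ivSet_iff.1 ht).1]
  have hband := isSemialgebraic_band₁
  have hden : ∀ v ∈ KZlog.band ivSet loEdge₁ upEdge₁,
      aeval v (4 * X 0 : MvPolynomial (Fin 2) ℚ) ≠ 0 := fun v hv => by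
    simpa using (mem_band₁.1 hv).1.1.ne'
  have hden' : ∀ v ∈ KZlog.band ivSet loEdge₁ upEdge₁,
      aeval v (2 * X 0 : MvPolynomial (Fin 2) ℚ) ≠ 0 := fun v hv => by
    simpa using (mem_band₁.1 hv).1.1.ne'
  set F : (Fin 2 → ℝ) → ℝ := fun v => (q : ℝ) * (v 1 ^ 2 - 4 * v 1) / (4 * v 0) + e * v 1 with hFdef
  set f : (Fin 2 → ℝ) → ℝ := fun v => (q : ℝ) * (v 1 - 2) / (2 * v 0) + e with hfdef
  have hbdry : ∀ t ∈ ivSet, F (Fin.snoc t (upEdge₁ t)) - F (Fin.snoc t (loEdge₁ t)) =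
      (affRep (e - q / 4) (-q / 2)).integrand t := by
    intro t ht
    have h0 : t 0 ≠ 0 := (mem_ivSet_iff.1 ht).1.ne'
    simp only [hFdef, snoc1_zero, snoc1_one, affRep_integrand, upEdge₁, loEdge₁]
    push_cast
    field_simp
    ring
  have hint : IntegrableOn f (KZlog.band ivSet loEdge₁ upEdge₁) := by
    refine integrableOn_of_null_diff ?_ triSet_subset_band₁ volume_band₁_diff_triSet
    have h := r.integrableOn
    rw [hr] at h
    exact h.congr_fun (fun t ht => hri t ht) isSemialgebraic_triSet.measurableSet_holds
  obtain ⟨rb, rd, hrbd, hrbi, hrdd, hrdi, hrel⟩ := KZ.exists_band_newtonLeibniz hBs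
    loEdge₁ upEdge₁ ha hb hab F f
    ((isSemialgebraicFunOn_aeval_div_aeval hband
      (C q * (X 1 ^ 2 - 4 * X 1) + C e * X 1 * (4 * X 0)) (4 * X 0) hden).congr fun v hv => by
        have h0 : v 0 ≠ 0 := (mem_band₁.1 hv).1.1.ne'
        simp only [hFdef]
        simp
        field_simp)
    ((isSemialgebraicFunOn_aeval_div_aeval hband (C q * (X 1 - 2) + C e * (2 * X 0)) (2 * X 0)
      hden').congr fun v hv => by
        have h0 : v 0 ≠ 0 := (mem_band₁.1 hv).1.1.ne'
        simp only [hfdef]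
        simp
        field_simp)
    (fun t _ => by
      simp only [hFdef, snoc1_zero, snoc1_one]
      fun_prop)
    (fun t ht s _ => by
      have h0 : t 0 ≠ 0 := (mem_ivSet_iff.1 ht).1.ne'
      simp only [hFdef, hfdef, snoc1_zero, snoc1_one]
      refine ((((( hasDerivAt_pow 2 s).sub ((hasDerivAt_id s).const_mul 4)).const_mul (q : ℝ)).div_const
        (4 * t 0)).add ((hasDerivAt_id s).const_mul (e : ℝ))).congr_deriv ?_
      simp
      field_simp
      ring)
    hint
    ((affRep (e - q / 4) (-q / 2)).isSemialgebraicFunOn_integrand.congr fun t ht => (hbdry t ht).symm)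
    (((affRep (e - q / 4) (-q / 2)).integrableOn.congr_fun (fun t ht => (hbdry t ht).symm)
      isSemialgebraic_ivSet.measurableSet_holds))
  obtain ⟨rb', hrb'd, hrb'i, hrel'⟩ := KZ.of_sub_of_restrict_openBand_mem_relations ha hb rb hrbd
  have hpin1 : KZ.of rb' - KZ.of r ∈ KZ.relations := by
    refine KZ.of_sub_of_mem_relations_of_eqOn ?_ fun v hv => ?_
    · rw [hrb'd, hr]
      ext v
      simp only [mem_triSet, mem_setOf_eq, mem_ivSet_iff, loEdge₁, upEdge₁, last_one_eq, init2_zero]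
      constructor
      · rintro ⟨⟨h0, h1⟩, hc⟩
        exact ⟨h0, by linarith, h1.2⟩
      · rintro ⟨h0, h1, h2⟩
        exact ⟨⟨h0, by linarith, h2⟩, by linarith⟩
    · rw [hrb'i, hrbi]
      rw [hrb'd] at hv
      obtain ⟨h0, h1, h2⟩ := hv
      rw [mem_ivSet_iff, init2_zero] at h0
      rw [last_one_eq] at h1 h2
      simp only [loEdge₁, upEdge₁] at h1 h2
      rw [init2_zero] at h1
      exact (hri v (mem_triSet.2 ⟨⟨h0, by linarith, h2⟩, by linarith⟩)).symm
  have hpin2 : KZ.of rd - KZ.of (affRep (e - q / 4) (-q / 2)) ∈ KZ.relations := by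
    refine KZ.of_sub_of_mem_relations_of_eqOn ?_ fun t ht => ?_
    · rw [affRep_domain, hrdd]
    · rw [hrdi]
      rw [hrdd] at ht
      exact hbdry t ht
  have : KZ.of r - KZ.of (affRep (e - q / 4) (-q / 2)) =
      (KZ.of rb - KZ.of rd) - (KZ.of rb - KZ.of rb') - (KZ.of rb' - KZ.of r) +
        (KZ.of rd - KZ.of (affRep (e - q / 4) (-q / 2))) := by abel
  rw [this]
  exact add_mem (sub_mem (sub_mem hrel hrel') hpin1) hpin2

/-! #### The Newton–Leibniz move `(0,1) → pt` -/

/-- **`[(0,1), αt₀ + β] − [pt, α/2 + β] ∈ KZ.relations`** (rules (3) + (1a); primitive `αt²/2 + βt`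
on `[0,1]`). [KontsevichZagier2001 §1.2 rules (1), (3)] -/
theorem of_affRep_sub_of_cstRep_mem_relations (α β : ℚ) :
    KZ.of (affRep α β) - KZ.of (cstRep (α / 2 + β)) ∈ KZ.relations := by
  have hBs : IsSemialgebraic ℚ (univ : Set (Fin 0 → ℝ)) := isSemialgebraic_univ
  set a : (Fin 0 → ℝ) → ℝ := fun _ => 0 with hadef
  set b : (Fin 0 → ℝ) → ℝ := fun _ => 1 with hbdef
  have ha : IsSemialgebraicFunOn ℚ univ a :=
    (isSemialgebraicFunOn_aeval hBs (C 0)).congr fun _ _ => by simp [hadef]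
  have hb : IsSemialgebraicFunOn ℚ univ b :=
    (isSemialgebraicFunOn_aeval hBs (C 1)).congr fun _ _ => by simp [hbdef]
  have hab : ∀ x ∈ (univ : Set (Fin 0 → ℝ)), a x ≤ b x := fun _ _ => by
    simp only [hadef, hbdef]; norm_num
  have hband : IsSemialgebraic ℚ (KZlog.band univ a b) := KZlog.isSemialgebraic_band ha hb
  have hmemb : ∀ v : Fin 1 → ℝ, v ∈ KZlog.band univ a b ↔ 0 ≤ v 0 ∧ v 0 ≤ 1 := fun v => by
    rw [KZlog.mem_band]
    simp only [mem_univ, true_and, hadef, hbdef]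
    rfl
  have hbandI : KZlog.band univ a b ⊆ Icc 0 1 := fun v hv => by
    have h := (hmemb v).1 hv
    exact ⟨fun j => by fin_cases j; exact h.1, fun j => by fin_cases j; exact h.2⟩
  set F : (Fin 1 → ℝ) → ℝ := fun v => (α : ℝ) * v 0 ^ 2 / 2 + β * v 0 with hFdef
  set f : (Fin 1 → ℝ) → ℝ := fun v => (α : ℝ) * v 0 + β with hfdef
  have hbdry : ∀ x : Fin 0 → ℝ, F (Fin.snoc x (b x)) - F (Fin.snoc x (a x)) =
      (cstRep (α / 2 + β)).integrand x := by
    intro x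
    simp only [hFdef, hadef, hbdef, snoc0_zero, cstRep_integrand]
    push_cast
    ring
  obtain ⟨rb, rd, hrbd, hrbi, hrdd, hrdi, hrel⟩ := KZ.exists_band_newtonLeibniz hBs a b ha hb hab F f
    ((isSemialgebraicFunOn_aeval hband (C α * X 0 ^ 2 * C (1 / 2) + C β * X 0)).congr fun v _ => by
      simp only [hFdef]; simp; ring)
    ((isSemialgebraicFunOn_aeval hband (C α * X 0 + C β)).congr fun v _ => by
      simp only [hfdef]; simp)
    (fun x _ => by
      simp only [hFdef, snoc0_zero]
      fun_prop)
    (fun x _ s _ => by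
      simp only [hFdef, hfdef, snoc0_zero]
      refine ((((hasDerivAt_pow 2 s).const_mul (α : ℝ)).div_const 2).add
        ((hasDerivAt_id s).const_mul (β : ℝ))).congr_deriv ?_
      simp
      ring)
    (integrableOn_of_bdd hbandI hband.measurableSet_holds (by simp only [hfdef]; fun_prop)
      (|(α : ℝ)| + |(β : ℝ)|) fun v hv => by
        have h := (hmemb v).1 hv
        simp only [hfdef]
        calc |(α : ℝ) * v 0 + β| ≤ |(α : ℝ) * v 0| + |(β : ℝ)| := abs_add_le _ _
          _ ≤ |(α : ℝ)| + |(β : ℝ)| := by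
            rw [abs_mul, abs_of_nonneg h.1]
            nlinarith [abs_nonneg (α : ℝ)])
    ((cstRep (α / 2 + β)).isSemialgebraicFunOn_integrand.congr fun x _ => (hbdry x).symm)
    (((cstRep (α / 2 + β)).integrableOn.congr_fun (fun x _ => (hbdry x).symm)
      MeasurableSet.univ))
  obtain ⟨rb', hrb'd, hrb'i, hrel'⟩ := KZ.of_sub_of_restrict_openBand_mem_relations ha hb rb hrbd
  have hpin1 : KZ.of rb' - KZ.of (affRep α β) ∈ KZ.relations := by
    refine KZ.of_sub_of_mem_relations_of_eqOn ?_ fun v _ => ?_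
    · rw [hrb'd, affRep_domain]
      ext v
      rw [mem_setOf_eq, mem_ivSet_iff, last_zero_eq]
      simp only [mem_univ, true_and, hadef, hbdef]
    · rw [hrb'i, hrbi]
      rfl
  have hpin2 : KZ.of rd - KZ.of (cstRep (α / 2 + β)) ∈ KZ.relations := by
    refine KZ.of_sub_of_mem_relations_of_eqOn ?_ fun x _ => ?_
    · rw [cstRep_domain, hrdd]
    · rw [hrdi]
      exact hbdry x
  have : KZ.of (affRep α β) - KZ.of (cstRep (α / 2 + β)) =
      (KZ.of rb - KZ.of rd) - (KZ.of rb - KZ.of rb') - (KZ.of rb' - KZ.of (affRep α β)) +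
        (KZ.of rd - KZ.of (cstRep (α / 2 + β))) := by abel
  rw [this]
  exact add_mem (sub_mem (sub_mem hrel hrel') hpin1) hpin2

/-! #### The two rational pieces are constants -/

/-- **`[B_q] − [pt, −q/8] ∈ KZ.relations`.** [KontsevichZagier2001 §1.2; this node] -/
theorem of_bRep_sub_of_cstRep_mem_relations (q : ℚ) :
    KZ.of (bRep q) - KZ.of (cstRep (-q / 8)) ∈ KZ.relations := by
  have h1 := of_sub_of_affRep_mem_relations q q (bRep q) rfl fun t _ => rfl
  have h2 := of_affRep_sub_of_cstRep_mem_relations (q - q / 4) (-q / 2)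
  have e : (q - q / 4) / 2 + -q / 2 = -q / 8 := by ring
  rw [e] at h2
  have : KZ.of (bRep q) - KZ.of (cstRep (-q / 8)) =
      (KZ.of (bRep q) - KZ.of (affRep (q - q / 4) (-q / 2))) +
        (KZ.of (affRep (q - q / 4) (-q / 2)) - KZ.of (cstRep (-q / 8))) := by abel
  rw [this]
  exact add_mem h1 h2

/-- The coordinate swap of `A_q` has domain `Δ` (which is symmetric). [definition] -/
theorem reindex_aRep_domain (q : ℚ) : ((aRep q).reindex (Equiv.swap 0 1)).domain = triSet := by
  ext w
  change (fun i => w (Equiv.swap 0 1 i)) ∈ triSet ↔ w ∈ triSet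
  rw [mem_triSet, mem_triSet]
  simp only [Equiv.swap_apply_left, Equiv.swap_apply_right]
  constructor
  · rintro ⟨⟨h1, h0⟩, hc⟩; exact ⟨⟨h0, h1⟩, by linarith⟩
  · rintro ⟨⟨h0, h1⟩, hc⟩; exact ⟨⟨h1, h0⟩, by linarith⟩

/-- **`[A_q] − [pt, −5q/8] ∈ KZ.relations`** (swap the coordinates, then the generic move with
`e = 0`). [KontsevichZagierPeriods2001 §1.2 rules (2), (3), (1); this node] -/
theorem of_aRep_sub_of_cstRep_mem_relations (q : ℚ) :
    KZ.of (aRep q) - KZ.of (cstRep (-(5 * q) / 8)) ∈ KZ.relations := by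
  have h0 := KZ.of_sub_of_reindex_mem_relations (aRep q) (Equiv.swap 0 1)
  have h1 := of_sub_of_affRep_mem_relations q 0 ((aRep q).reindex (Equiv.swap 0 1))
    (reindex_aRep_domain q) fun t _ => by
      change (aRep q).integrand (fun i => t (Equiv.swap 0 1 i)) = _
      rw [aRep_integrand]
      simp only [Equiv.swap_apply_left, Equiv.swap_apply_right, Rat.cast_zero, add_zero]
  have h2 := of_affRep_sub_of_cstRep_mem_relations (0 - q / 4) (-q / 2)
  have e : (0 - q / 4) / 2 + -q / 2 = -(5 * q) / 8 := by ring
  rw [e] at h2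
  have : KZ.of (aRep q) - KZ.of (cstRep (-(5 * q) / 8)) =
      (KZ.of (aRep q) - KZ.of ((aRep q).reindex (Equiv.swap 0 1))) +
      (KZ.of ((aRep q).reindex (Equiv.swap 0 1)) - KZ.of (affRep (0 - q / 4) (-q / 2))) +
        (KZ.of (affRep (0 - q / 4) (-q / 2)) - KZ.of (cstRep (-(5 * q) / 8))) := by abel
  rw [this]
  exact add_mem (add_mem h0 h1) h2

/-! #### Assembly: the split cell is Beukers' square plus a rational point -/

/-- **`[Δ_q] − ([zRep (q/2)] + [pt, −3q/4]) ∈ KZ.relations`.** [this node] -/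
theorem of_triRep_sub_zRep_cst_mem_relations (q : ℚ) :
    KZ.of (triRep q) - (KZ.of (zRep (q / 2)) + KZ.of (cstRep (-(3 * q) / 4))) ∈ KZ.relations := by
  have h1 := of_triRep_sub_pieces_mem_relations q
  have h2 := of_aRep_sub_of_cstRep_mem_relations q
  have h3 := of_bRep_sub_of_cstRep_mem_relations q
  have h4 := of_cstRep_add (-(5 * q) / 8) (-q / 8)
  have e : -(5 * q) / 8 + -q / 8 = -(3 * q) / 4 := by ring
  rw [e] at h4
  have : KZ.of (triRep q) - (KZ.of (zRep (q / 2)) + KZ.of (cstRep (-(3 * q) / 4))) =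
      (KZ.of (triRep q) - KZ.of (zRep (q / 2)) - KZ.of (aRep q) - KZ.of (bRep q)) +
        (KZ.of (aRep q) - KZ.of (cstRep (-(5 * q) / 8))) +
          (KZ.of (bRep q) - KZ.of (cstRep (-q / 8))) -
            (KZ.of (cstRep (-(3 * q) / 4)) - KZ.of (cstRep (-(5 * q) / 8)) -
              KZ.of (cstRep (-q / 8))) := by abel
  rw [this]
  exact sub_mem (add_mem (add_mem h1 h2) h3) h4

/-- **The split specimen inside the rules: `[(0,1)⁴ ∩ {x₀x₁ + x₂x₃ > 1}, q] −
([zRep (q/2)] + [pt, −3q/4]) ∈ KZ.relations`** — the split quadric 4-cell with constant weight `q` is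
equivalent, under the three KZ rules and unconditionally, to Beukers' `ζ(2)`-square with weight `q/2`
plus the rational point `−3q/4` (values `q(π²/12 − 3/4)` both sides).
[KontsevichZagier2001 §1.2; Beukers1979 §2; this node] -/
theorem of_split4_cell_sub_mem_relations (q : ℚ) :
    KZ.of (cellRep split4Poly q) - (KZ.of (zRep (q / 2)) + KZ.of (cstRep (-(3 * q) / 4))) ∈
      KZ.relations := by
  have h1 := of_cell_sub_of_triRep_mem_relations q
  have h2 := of_triRep_sub_zRep_cst_mem_relations q
  have : KZ.of (cellRep split4Poly q) - (KZ.of (zRep (q / 2)) + KZ.of (cstRep (-(3 * q) / 4))) =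
      (KZ.of (cellRep split4Poly q) - KZ.of (triRep q)) +
        (KZ.of (triRep q) - (KZ.of (zRep (q / 2)) + KZ.of (cstRep (-(3 * q) / 4)))) := by abel
  rw [this]
  exact add_mem h1 h2

/-- Value bookkeeping (not used in any move): `value (zRep (q/2)) + value [pt, −3q/4] =
q(π²/12 − 3/4)`, the value of the split cell computed in gen 10. [this node] -/
theorem value_zRep_add_value_cstRep (q : ℚ) :
    (zRep (q / 2)).value + (cstRep (-(3 * q) / 4)).value = (q : ℝ) * (Real.pi ^ 2 / 12 - 3 / 4) := by
  rw [value_zRep, PiSector.value_cstRep]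
  push_cast
  ring

end Summit.KontsevichZagierPeriods.RootDecompWalshStrata.Split4Pi

end
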